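import Summits.QuantumFields.QCD.Theorems.PauliWegnerSeaPhaseQuenchedFlavourDecayEntryMomentFinal
import Summits.QuantumFields.QCD.Theorems.PauliWegnerSeaPhaseQuenchedFlavourDecayJacobiComplementaryMinor
import Summits.QuantumFields.QCD.Theorems.PauliWegnerSeaPhaseQuenchedFlavourDecayGramOfColumns
import Summits.QuantumFields.QCD.Theorems.PauliWegnerSeaPhaseQuenchedFlavourDecayGramMomentIntegrableAllR

/-!
# The integrability conjunct of the open core `stub_gramMomentsCore` for every minor size — unconditional form
(crux stmt-QuantumFields-9151 `PauliWegnerSea.PhaseQuenchedFlavourDecay`, line `crossing-split-integrability`, lead c4)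

Assembly only: `stub_gramMomentIntegrableOf` (`…GramMomentIntegrableAllR`) applied to the landed inputs
`stub_wilsonDetNegMoment` (uniform-window negative moments of the Wilson determinant), `stub_jacobiComplementaryMinor`
(Jacobi) and `stub_gramOfColumns_det_ne_zero`.  Result (`stub_gramMomentIntegrable`, registered): there is `s₀ > 0` (independent of
everything) such that for `1/2 < q < (1+s₀)/2`, every `N_f`, torus of side `≥ 4`, `β`, mass vector, flavour `f`, size `r`
and rows `I : Fin r → QuarkIdx`, the `q`-th power of the principal Gram minor `Re det((GGᴴ)[(f,I),(f,I)])` of the inverse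
fermion matrix is integrable under the phase-quenched measure — i.e. the FINITE-VOLUME FINITENESS of the core's moments
(single-flavour rows) is a theorem with an `r`-independent exponent window; the open content of the core is the UNIFORMITY of
the bound in the volume and along the regularisation.
-/

noncomputable section

namespace Summit.QuantumFields.QCD.Cruxes.PhaseQuenchedFlavourDecay.CrossingSplitIntegrability

open MeasureTheory
open Literature.MathematicalPhysics.QuantumFieldTheory Literature.MathematicalPhysics.QuantumLattice
  Literature.Probability.LatticeModels

/-- **Integrability conjunct of the open core for every minor size `r`, unconditionally** (single-flavour rows):
`∃ s₀ > 0, ∀ q ∈ (1/2, (1+s₀)/2), ∀ N_f, L ≥ 4, β, mq, f, r, I, Integrable ((Re det((GGᴴ)[(f,I),(f,I)]))^q) (qcdLatticeMeasure L β mq)`. -/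
theorem stub_gramMomentIntegrable :
    ∃ s₀ : ℝ, 0 < s₀ ∧ ∀ q : ℝ, 1 / 2 < q → q < (1 + s₀) / 2 → ∀ (Nf L : ℕ) [NeZero L], 4 ≤ L →
      ∀ (β : ℝ) (mq : Fin Nf → ℝ) (f : Fin Nf) (r : ℕ) (I : Fin r → TorusSite 4 L × Fin 3 × Fin 4),
        MeasureTheory.Integrable (fun U : GaugeConfig 4 L SU3 =>
          (Matrix.of fun a b : Fin r =>
            ((diracMatrix U mq)⁻¹ * ((diracMatrix U mq)⁻¹).conjTranspose)
              (quarkEquiv (f, I a)) (quarkEquiv (f, I b))).det.re ^ q) (qcdLatticeMeasure L β mq) :=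
  stub_gramMomentIntegrableOf stub_wilsonDetNegMoment stub_jacobiComplementaryMinor stub_gramOfColumns_det_ne_zero

end Summit.QuantumFields.QCD.Cruxes.PhaseQuenchedFlavourDecay.CrossingSplitIntegrability

end
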